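import Literature.AlgebraicGeometry.Motives.ComplexPointsSubmersion
import Literature.NumberTheory.Transcendental.AnalytificationProofs
import Literature.Analysis.Complex.InjectiveHolomorphic
import HarnessLib

/-!
# Injective families of regular functions are charts of `X(ℂ)` (Serre GAGA §2 + Clements–Osgood)

Let `X` be a scheme smooth of relative dimension `e` and locally of finite type over `ℂ`, `O ⊆ X(ℂ)` an open
set of complex points and `u = (u_t)_{t ∈ ι} : X(ℂ) → ℂ^ι`, `#ι = e`, a family of functions each of which is,
on `O`, (the total evaluation of) a regular function on a Zariski open set. If `u` is INJECTIVE on `O`, then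
`u|_O` is a chart of the complex manifold `X(ℂ)`: its differential is invertible at every point of `O`, its
image is open, and it is a homeomorphism onto the image whose inverse is holomorphic, in particular `C^∞`
for the tree's real structure `ComplexPoints.chartedSpace X e`.

Proof: in an algebraic chart `a` of `X(ℂ)` (`ComplexPoints.algebraicChart`; Serre, GAGA §2 n°5 Prop. 2:
regular functions are holomorphic in it, `ComplexPoints.algebraicChart_spec`) the map `u ∘ a⁻¹` is an
injective holomorphic map between open pieces of `ℂᵉ`, hence has invertible differential and open image
by the Clements–Osgood theorem (Fritzsche–Grauert I §8 Thm. 8.5, Cor. 8.6 — the tree's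
`Literature.Analysis.Complex.SCV.bijective_fderiv_of_injOn`, `isOpen_image_of_injOn`), and the inverse of
the resulting partial homeomorphism is holomorphic (Mathlib `OpenPartialHomeomorph.contDiffAt_symm`).
This is how explicit regular coordinates (affine coordinates of an embedded piece, coefficients of a
family) are certified to be charts of `X(ℂ)` without constructing points from coordinates.

* `contDiffOn_evalOrZero_comp_symm_opens` — a regular function on ANY open `U`, read in an algebraic
  chart, is holomorphic on the chart image of `U(ℂ)` (affine case = `algebraicChart_spec`; restrict to
  affine opens, `AlgPoints.evalOrZero_map_homOfLE`);
* `contDiffOn_comp_symm_of_regular`, `contMDiffAt_of_regular` — `u ∘ a⁻¹` is holomorphic on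
  `a(O)`, and `u` is `C^∞` at the points of `O`;
* `bijective_fderiv_comp_symm_of_injOn` — for `u` injective on `O`: `D(u ∘ a⁻¹)` is bijective on `a(O)`;
* `bijective_mfderiv_of_regular_injOn` — the manifold differential of `u` is bijective at points of `O`;
* `isOpen_image_of_regular_injOn`, `isOpenMap_restrict_of_regular_injOn` — `u(O)` is open, `u|_O` is open;
* `exists_openPartialHomeomorph_of_regular_injOn` — `u|_O` as an `OpenPartialHomeomorph` with source `O`,
  `C^∞` on `O` with `C^∞` inverse on `u(O)`.

Everything is proved; no definitions, no named facts. Statements about the real manifold structure carry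
`letI := ComplexPoints.chartedSpace X e`.

## References

* [SerreGAGA1956] J.-P. Serre, Géométrie algébrique et géométrie analytique, Ann. Inst. Fourier 6 (1956),
  §2 n°5 Prop. 2, n°6 («toute fonction régulière est holomorphe»; «Xʰ est une sous-variété analytique au
  voisinage d'un point simple»).
* [FritzscheGrauert2002] K. Fritzsche, H. Grauert, From Holomorphic Functions to Complex Manifolds (2002),
  Ch. I §8 Thm. 8.5, Cor. 8.6.
-/

noncomputable section

open CategoryTheory AlgebraicGeometry Filter Topology Set
open scoped ContDiff Manifold
open Literature.AlgebraicGeometry.Motives.AlgPoints (evalOrZero)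
open Literature.NumberTheory.Transcendental
open Literature.Analysis.Complex

namespace Literature.AlgebraicGeometry.Motives.ComplexPoints

variable (X : SchemeOver ℂ) (e : ℕ) [LocallyOfFiniteType X.hom] [SmoothOfRelativeDimension e X.hom]

/-! ### Regular functions on arbitrary opens, read in an algebraic chart -/

/-- **A regular function on any open `U`, read in the algebraic chart at `P`, is holomorphic on the chart
image of `U(ℂ)`**: near a point restrict to an affine open `V ⊆ U` (`algebraicChart_spec` is stated for affine
opens) and use `evalOrZero V (s|_V) = evalOrZero U s` on `V(ℂ)`. [cite: SerreGAGA1956, §2 n°5 Prop. 2, n°6] -/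
theorem contDiffOn_evalOrZero_comp_symm_opens (P : ComplexPoints X) (U : X.left.Opens) (s : Γ(X.left, U)) :
    ContDiffOn ℂ ω (evalOrZero U s ∘ (algebraicChart X e P).symm)
      ((algebraicChart X e P).target ∩ (algebraicChart X e P).symm ⁻¹' {Q | Q.pt ∈ U}) := by
  intro w hw
  obtain ⟨V, hVaff, hQV, hVU⟩ := exists_isAffineOpen_mem_and_subset (X := X.left) (U := U) hw.2
  have hVU' : V ≤ U := hVU
  obtain ⟨-, hol⟩ := algebraicChart_spec X e P
  have h := hol ⟨V, hVaff⟩ (X.left.presheaf.map (homOfLE hVU').op s)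
  have hopen : IsOpen ((algebraicChart X e P).target ∩
      (algebraicChart X e P).symm ⁻¹' {Q | Q.pt ∈ V}) :=
    (algebraicChart X e P).isOpen_inter_preimage_symm (AlgPoints.isOpen_setOf_pt_mem _)
  have hwV : w ∈ (algebraicChart X e P).target ∩ (algebraicChart X e P).symm ⁻¹' {Q | Q.pt ∈ V} :=
    ⟨hw.1, hQV⟩
  have hcd : ContDiffAt ℂ ω (evalOrZero U s ∘ (algebraicChart X e P).symm) w := by
    refine (h.contDiffAt (hopen.mem_nhds hwV)).congr_of_eventuallyEq ?_
    filter_upwards [hopen.mem_nhds hwV] with w' hw'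
    exact (AlgPoints.evalOrZero_map_homOfLE hVU' s hw'.2).symm
  exact hcd.contDiffWithinAt

/-! ### Families of regular functions -/

section Regular

variable {X e}
variable {ι : Type*} [Fintype ι] {O : Set (ComplexPoints X)} {u : ComplexPoints X → ι → ℂ}

/-- **`u ∘ a⁻¹` is holomorphic on `a(O)`** for a family `u` of functions that are regular on `O`.
[cite: SerreGAGA1956, §2 n°5 Prop. 2, n°6] -/
theorem contDiffOn_comp_symm_of_regular
    (hu : ∀ t, ∃ (U : X.left.Opens) (s : Γ(X.left, U)), O ⊆ {Q | Q.pt ∈ U} ∧ ∀ Q ∈ O, u Q t = evalOrZero U s Q)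
    (P : ComplexPoints X) :
    ContDiffOn ℂ ω (u ∘ (algebraicChart X e P).symm)
      ((algebraicChart X e P).target ∩ (algebraicChart X e P).symm ⁻¹' O) := by
  rw [contDiffOn_pi]
  intro t
  obtain ⟨U, s, hOU, hus⟩ := hu t
  refine ((contDiffOn_evalOrZero_comp_symm_opens X e P U s).mono ?_).congr ?_
  · rintro w ⟨hw, hw'⟩
    exact ⟨hw, hOU hw'⟩
  · rintro w ⟨-, hw'⟩
    exact hus _ hw'

/-- **Functions regular on an open `O` are `C^∞` at the points of `O`** (real structure
`ComplexPoints.chartedSpace X e`). [cite: SerreGAGA1956, §2 n°6] -/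
theorem contMDiffAt_of_regular (hO : IsOpen O)
    (hu : ∀ t, ∃ (U : X.left.Opens) (s : Γ(X.left, U)), O ⊆ {Q | Q.pt ∈ U} ∧ ∀ Q ∈ O, u Q t = evalOrZero U s Q)
    {Q : ComplexPoints X} (hQ : Q ∈ O) :
    letI := ComplexPoints.chartedSpace X e
    ContMDiffAt (𝓡 (2 * e)) 𝓘(ℝ, ι → ℂ) ∞ u Q := by
  letI := ComplexPoints.chartedSpace X e
  set L := ContinuousLinearEquiv.ofFinrankEq (finrank_real_pi_complex_eq e) with hL
  set a := algebraicChart X e Q with ha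
  have hS : IsOpen (a.target ∩ a.symm ⁻¹' O) := a.isOpen_inter_preimage_symm hO
  have haQ : a Q ∈ a.target ∩ a.symm ⁻¹' O :=
    ⟨a.map_source (mem_algebraicChart_source X e Q), by
      simp only [mem_preimage, a.left_inv (mem_algebraicChart_source X e Q)]; exact hQ⟩
  have hcont : ContinuousAt u Q := by
    have h1 : ContinuousAt (u ∘ a.symm) (a Q) :=
      ((contDiffOn_comp_symm_of_regular hu Q).continuousOn.continuousAt (hS.mem_nhds haQ))
    have h2 : ContinuousAt a Q := a.continuousAt (mem_algebraicChart_source X e Q)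
    have h3 := h1.comp h2
    refine h3.congr ?_
    filter_upwards [a.open_source.mem_nhds (mem_algebraicChart_source X e Q)] with Q' hQ'
    simp only [Function.comp_apply, a.left_inv hQ']
  have key : ContDiffAt ℝ ∞ (fun z : EuclideanSpace ℝ (Fin (2 * e)) =>
      u (a.symm ((complexToEuclidean e).symm z))) (complexToEuclidean e (a Q)) := by
    have h1 : ContDiffAt ℝ ∞ (u ∘ a.symm) ((complexToEuclidean e).symm (complexToEuclidean e (a Q))) := by
      rw [Homeomorph.symm_apply_apply]
      exact (((contDiffOn_comp_symm_of_regular hu Q).contDiffAt (hS.mem_nhds haQ)).restrict_scalars ℝ).of_le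
        le_top
    have h2 : ContDiffAt ℝ ∞ (⇑(complexToEuclidean e).symm) (complexToEuclidean e (a Q)) := by
      rw [coe_complexToEuclidean_symm]
      exact L.symm.contDiff.contDiffAt
    exact h1.comp _ h2
  rw [contMDiffAt_iff]
  refine ⟨hcont, ?_⟩
  have hF : (extChartAt 𝓘(ℝ, ι → ℂ) (u Q)) ∘ u ∘ (extChartAt (𝓡 (2 * e)) Q).symm =
      fun z : EuclideanSpace ℝ (Fin (2 * e)) => u (a.symm ((complexToEuclidean e).symm z)) := by
    funext z
    rfl
  have hpt : extChartAt (𝓡 (2 * e)) Q Q = complexToEuclidean e (a Q) := rfl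
  have hr : Set.range (𝓡 (2 * e)) = Set.univ := by
    simp only [modelWithCornersSelf_coe, Set.range_id]
  rw [hF, hpt, hr, contDiffWithinAt_univ]
  exact key

/-- The dimension count `dim ℂᵉ = dim ℂ^ι` for `#ι = e`. [folklore] -/
private theorem finrank_eq_of_card_eq (hcard : Fintype.card ι = e) :
    Module.finrank ℂ (Fin e → ℂ) = Module.finrank ℂ (ι → ℂ) := by
  rw [Module.finrank_fin_fun, Module.finrank_fintype_fun_eq_card, hcard]

/-- **Clements–Osgood in an algebraic chart**: if the regular family `u` (`#ι = e`) is injective on the open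
`O`, then `D(u ∘ a⁻¹)` is bijective at the chart image of every point of `O` in the chart domain.
[cite: FritzscheGrauert2002, Ch. I §8 Thm. 8.5] [cite: SerreGAGA1956, §2 n°6] -/
theorem bijective_fderiv_comp_symm_of_injOn (hO : IsOpen O) (hcard : Fintype.card ι = e)
    (hu : ∀ t, ∃ (U : X.left.Opens) (s : Γ(X.left, U)), O ⊆ {Q | Q.pt ∈ U} ∧ ∀ Q ∈ O, u Q t = evalOrZero U s Q)
    (hinj : InjOn u O) (P : ComplexPoints X) {Q : ComplexPoints X} (hQ : Q ∈ O)
    (hQs : Q ∈ (algebraicChart X e P).source) :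
    Function.Bijective (fderiv ℂ (u ∘ (algebraicChart X e P).symm) (algebraicChart X e P Q)) := by
  set a := algebraicChart X e P with ha
  have hS : IsOpen (a.target ∩ a.symm ⁻¹' O) := a.isOpen_inter_preimage_symm hO
  have hdiff : DifferentiableOn ℂ (u ∘ a.symm) (a.target ∩ a.symm ⁻¹' O) :=
    (contDiffOn_comp_symm_of_regular hu P).differentiableOn (by simp)
  have hinjS : InjOn (u ∘ a.symm) (a.target ∩ a.symm ⁻¹' O) := by
    intro w hw w' hw' h
    exact a.symm.injOn hw.1 hw'.1 (hinj hw.2 hw'.2 h)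
  exact SCV.bijective_fderiv_of_injOn (finrank_eq_of_card_eq hcard) hdiff hS hinjS
    ⟨a.map_source hQs, by simp only [mem_preimage, a.left_inv hQs]; exact hQ⟩

/-- **The manifold differential of an injective regular family is bijective** at the points of `O` (real
structure `ComplexPoints.chartedSpace X e`, target `ℂ^ι` as a real vector space).
[cite: FritzscheGrauert2002, Ch. I §8 Thm. 8.5] [cite: SerreGAGA1956, §2 n°6] -/
theorem bijective_mfderiv_of_regular_injOn (hO : IsOpen O) (hcard : Fintype.card ι = e)
    (hu : ∀ t, ∃ (U : X.left.Opens) (s : Γ(X.left, U)), O ⊆ {Q | Q.pt ∈ U} ∧ ∀ Q ∈ O, u Q t = evalOrZero U s Q)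
    (hinj : InjOn u O) {Q : ComplexPoints X} (hQ : Q ∈ O) :
    letI := ComplexPoints.chartedSpace X e
    Function.Bijective (mfderiv (𝓡 (2 * e)) 𝓘(ℝ, ι → ℂ) u Q) := by
  letI := ComplexPoints.chartedSpace X e
  haveI := isManifold_real X e
  set L := ContinuousLinearEquiv.ofFinrankEq (finrank_real_pi_complex_eq e) with hL
  set a := algebraicChart X e Q with ha
  have hmd : MDifferentiableAt (𝓡 (2 * e)) 𝓘(ℝ, ι → ℂ) u Q :=
    (contMDiffAt_of_regular hO hu hQ).mdifferentiableAt (by simp)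
  rw [hmd.mfderiv]
  have hw : writtenInExtChartAt (𝓡 (2 * e)) 𝓘(ℝ, ι → ℂ) Q u =
      (u ∘ a.symm) ∘ ⇑(complexToEuclidean e).symm := by
    funext z
    rfl
  have hpt : extChartAt (𝓡 (2 * e)) Q Q = complexToEuclidean e (a Q) := rfl
  have hr : Set.range (𝓡 (2 * e)) = Set.univ := by
    simp only [modelWithCornersSelf_coe, Set.range_id]
  rw [hw, hpt, hr, fderivWithin_univ, coe_complexToEuclidean, coe_complexToEuclidean_symm]
  have hS : IsOpen (a.target ∩ a.symm ⁻¹' O) := a.isOpen_inter_preimage_symm hO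
  have haQ : a Q ∈ a.target ∩ a.symm ⁻¹' O :=
    ⟨a.map_source (mem_algebraicChart_source X e Q), by
      simp only [mem_preimage, a.left_inv (mem_algebraicChart_source X e Q)]; exact hQ⟩
  have hd : DifferentiableAt ℂ (u ∘ a.symm) (a Q) :=
    ((contDiffOn_comp_symm_of_regular hu Q).differentiableOn (by simp)).differentiableAt (hS.mem_nhds haQ)
  have hB := bijective_fderiv_comp_symm_of_injOn hO hcard hu hinj Q hQ (mem_algebraicChart_source X e Q)
  have h1 : HasFDerivAt ((u ∘ a.symm) ∘ ⇑L.symm)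
      (((fderiv ℂ (u ∘ a.symm) (a Q)).restrictScalars ℝ).comp (L.symm : _ →L[ℝ] (Fin e → ℂ)))
      (L (a Q)) := by
    have h0 : HasFDerivAt (u ∘ a.symm) ((fderiv ℂ (u ∘ a.symm) (a Q)).restrictScalars ℝ)
        (L.symm (L (a Q))) := by
      rw [L.symm_apply_apply]
      exact hd.hasFDerivAt.restrictScalars ℝ
    exact h0.comp _ L.symm.hasFDerivAt
  rw [h1.fderiv]
  exact hB.comp L.symm.bijective

/-- **The image `u(O)` of an injective regular family is open.**
[cite: FritzscheGrauert2002, Ch. I §8 Cor. 8.6] [cite: SerreGAGA1956, §2 n°6] -/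
theorem isOpen_image_of_regular_injOn (hO : IsOpen O) (hcard : Fintype.card ι = e)
    (hu : ∀ t, ∃ (U : X.left.Opens) (s : Γ(X.left, U)), O ⊆ {Q | Q.pt ∈ U} ∧ ∀ Q ∈ O, u Q t = evalOrZero U s Q)
    (hinj : InjOn u O) : IsOpen (u '' O) := by
  rw [isOpen_iff_mem_nhds]
  rintro _ ⟨Q, hQ, rfl⟩
  set a := algebraicChart X e Q with ha
  have hS : IsOpen (a.target ∩ a.symm ⁻¹' O) := a.isOpen_inter_preimage_symm hO
  have haQ : a Q ∈ a.target ∩ a.symm ⁻¹' O :=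
    ⟨a.map_source (mem_algebraicChart_source X e Q), by
      simp only [mem_preimage, a.left_inv (mem_algebraicChart_source X e Q)]; exact hQ⟩
  have hdiff : DifferentiableOn ℂ (u ∘ a.symm) (a.target ∩ a.symm ⁻¹' O) :=
    (contDiffOn_comp_symm_of_regular hu Q).differentiableOn (by simp)
  have hinjS : InjOn (u ∘ a.symm) (a.target ∩ a.symm ⁻¹' O) := by
    intro w hw w' hw' h
    exact a.symm.injOn hw.1 hw'.1 (hinj hw.2 hw'.2 h)
  have hopen := SCV.isOpen_image_of_injOn (finrank_eq_of_card_eq hcard) hdiff hS hinjS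
  have hsub : (u ∘ a.symm) '' (a.target ∩ a.symm ⁻¹' O) ⊆ u '' O := by
    rintro _ ⟨w, hw, rfl⟩
    exact ⟨a.symm w, hw.2, rfl⟩
  have hmem : u Q ∈ (u ∘ a.symm) '' (a.target ∩ a.symm ⁻¹' O) :=
    ⟨a Q, haQ, by simp only [Function.comp_apply, a.left_inv (mem_algebraicChart_source X e Q)]⟩
  exact mem_of_superset (hopen.mem_nhds hmem) hsub

/-- **`u|_O` is an open map** (apply `isOpen_image_of_regular_injOn` to the open subsets of `O`).
[cite: FritzscheGrauert2002, Ch. I §8 Cor. 8.6] -/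
theorem isOpenMap_restrict_of_regular_injOn (hO : IsOpen O) (hcard : Fintype.card ι = e)
    (hu : ∀ t, ∃ (U : X.left.Opens) (s : Γ(X.left, U)), O ⊆ {Q | Q.pt ∈ U} ∧ ∀ Q ∈ O, u Q t = evalOrZero U s Q)
    (hinj : InjOn u O) : IsOpenMap (O.restrict u) := by
  intro V hV
  obtain ⟨V', hV', rfl⟩ := isOpen_induced_iff.1 hV
  have himg : O.restrict u '' (Subtype.val ⁻¹' V') = u '' (O ∩ V') := by
    ext y
    constructor
    · rintro ⟨⟨Q, hQO⟩, hQV, rfl⟩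
      exact ⟨Q, ⟨hQO, hQV⟩, rfl⟩
    · rintro ⟨Q, ⟨hQO, hQV⟩, rfl⟩
      exact ⟨⟨Q, hQO⟩, hQV, rfl⟩
  rw [himg]
  refine isOpen_image_of_regular_injOn (hO.inter hV') hcard (fun t => ?_) (hinj.mono inter_subset_left)
  obtain ⟨U, s, hOU, hus⟩ := hu t
  exact ⟨U, s, fun Q hQ => hOU hQ.1, fun Q hQ => hus Q hQ.1⟩

/-- **An injective regular family is a `C^∞` chart with `C^∞` inverse.** There is an open partial
homeomorphism `Φ` of `X(ℂ)` onto the open set `u(O) ⊆ ℂ^ι` with `Φ = u`, source `O`, which is `C^∞` on `O`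
and whose inverse is `C^∞` on `u(O)` (indeed holomorphic in the algebraic charts: the inverse of a
holomorphic homeomorphism with invertible differential). [cite: FritzscheGrauert2002, Ch. I §8 Cor. 8.6]
[cite: SerreGAGA1956, §2 n°6] -/
theorem exists_openPartialHomeomorph_of_regular_injOn (hO : IsOpen O) (hne : O.Nonempty)
    (hcard : Fintype.card ι = e)
    (hu : ∀ t, ∃ (U : X.left.Opens) (s : Γ(X.left, U)), O ⊆ {Q | Q.pt ∈ U} ∧ ∀ Q ∈ O, u Q t = evalOrZero U s Q)
    (hinj : InjOn u O) :
    letI := ComplexPoints.chartedSpace X e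
    ∃ Φ : OpenPartialHomeomorph (ComplexPoints X) (ι → ℂ), ⇑Φ = u ∧ Φ.source = O ∧ Φ.target = u '' O ∧
      ContMDiffOn (𝓡 (2 * e)) 𝓘(ℝ, ι → ℂ) ∞ Φ O ∧
      ContMDiffOn 𝓘(ℝ, ι → ℂ) (𝓡 (2 * e)) ∞ Φ.symm (u '' O) := by
  letI := ComplexPoints.chartedSpace X e
  haveI := isManifold_real X e
  haveI : Nonempty (ComplexPoints X) := ⟨hne.some⟩
  set L := ContinuousLinearEquiv.ofFinrankEq (finrank_real_pi_complex_eq e) with hL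
  -- the partial homeomorphism
  have hcontO : ContinuousOn u O := fun Q hQ =>
    (contMDiffAt_of_regular (e := e) hO hu hQ).continuousAt.continuousWithinAt
  let Φ : OpenPartialHomeomorph (ComplexPoints X) (ι → ℂ) :=
    OpenPartialHomeomorph.ofContinuousOpenRestrict (hinj.toPartialEquiv u O) hcontO
      (isOpenMap_restrict_of_regular_injOn hO hcard hu hinj) hO
  have hΦ : ⇑Φ = u := rfl
  have hΦs : Φ.source = O := rfl
  have hΦt : Φ.target = u '' O := rfl
  refine ⟨Φ, hΦ, hΦs, hΦt, fun Q hQ => (contMDiffAt_of_regular hO hu hQ).contMDiffWithinAt, ?_⟩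
  -- smoothness of the inverse at `y = u Q`
  rintro _ ⟨Q, hQ, rfl⟩
  set a := algebraicChart X e Q with ha
  have hQs : Q ∈ a.source := mem_algebraicChart_source X e Q
  have hΦQ : Φ.symm (u Q) = Q := by
    rw [← hΦ]; exact Φ.left_inv (show Q ∈ Φ.source from hQ)
  -- the composite chart `T = a ∘ Φ⁻¹ : ℂ^ι ⇀ ℂᵉ`, whose inverse is `u ∘ a⁻¹`
  set T : OpenPartialHomeomorph (ι → ℂ) (Fin e → ℂ) := Φ.symm.trans a with hT
  have hyT : u Q ∈ T.source := by
    refine ⟨⟨Q, hQ, rfl⟩, ?_⟩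
    change Φ.symm (u Q) ∈ a.source
    rw [hΦQ]; exact hQs
  have hTsymm : ⇑T.symm = u ∘ a.symm := by
    funext w; rfl
  have hS : IsOpen (a.target ∩ a.symm ⁻¹' O) := a.isOpen_inter_preimage_symm hO
  have haQ : a Q ∈ a.target ∩ a.symm ⁻¹' O :=
    ⟨a.map_source hQs, by simp only [mem_preimage, a.left_inv hQs]; exact hQ⟩
  have hTy : T (u Q) = a Q := by
    change a (Φ.symm (u Q)) = a Q
    rw [hΦQ]
  -- `T` is holomorphic at `u Q`: inverse function theorem for `T.symm = u ∘ a⁻¹`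
  have hB := bijective_fderiv_comp_symm_of_injOn hO hcard hu hinj Q hQ hQs
  set D : (Fin e → ℂ) ≃L[ℂ] (ι → ℂ) := ContinuousLinearEquiv.ofBijective (fderiv ℂ (u ∘ a.symm) (a Q))
    (LinearMap.ker_eq_bot.2 hB.1) (LinearMap.range_eq_top.2 hB.2) with hD
  have hcd : ContDiffAt ℂ ω (u ∘ a.symm) (a Q) :=
    (contDiffOn_comp_symm_of_regular hu Q).contDiffAt (hS.mem_nhds haQ)
  have hderiv : HasFDerivAt (u ∘ a.symm) (D : (Fin e → ℂ) →L[ℂ] (ι → ℂ)) (a Q) := by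
    rw [hD, ContinuousLinearEquiv.coe_ofBijective]
    exact (hcd.differentiableAt (by simp)).hasFDerivAt
  have hTcd : ContDiffAt ℂ ω T (u Q) := by
    have hmem : u Q ∈ T.symm.target := by rw [T.symm_target]; exact hyT
    have h1 : T.symm.symm (u Q) = a Q := by rw [T.symm_symm]; exact hTy
    have h := T.symm.contDiffAt_symm hmem (by rw [h1, hTsymm]; exact hderiv) (by rw [h1, hTsymm]; exact hcd)
    rwa [T.symm_symm] at h
  -- read `Φ.symm` in the charts: `extChartAt Q ∘ Φ.symm = L ∘ T` near `u Q`
  refine ContMDiffAt.contMDiffWithinAt ?_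
  rw [contMDiffAt_iff]
  refine ⟨(Φ.continuousOn_symm.continuousAt (Φ.open_target.mem_nhds ⟨Q, hQ, rfl⟩)), ?_⟩
  have hr : Set.range 𝓘(ℝ, ι → ℂ) = Set.univ := by
    simp only [modelWithCornersSelf_coe, Set.range_id]
  rw [hr, contDiffWithinAt_univ]
  have hF : (extChartAt (𝓡 (2 * e)) (Φ.symm (u Q))) ∘ Φ.symm ∘ (extChartAt 𝓘(ℝ, ι → ℂ) (u Q)).symm =
      fun y => complexToEuclidean e (algebraicChart X e (Φ.symm (u Q)) (Φ.symm y)) := by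
    funext y
    rfl
  have hpt : extChartAt 𝓘(ℝ, ι → ℂ) (u Q) (u Q) = u Q := rfl
  rw [hF, hpt, hΦQ, coe_complexToEuclidean]
  have hev : (fun y => L (algebraicChart X e Q (Φ.symm y))) =ᶠ[𝓝 (u Q)] fun y => L (T y) := by
    filter_upwards [T.open_source.mem_nhds hyT] with y hy
    rfl
  refine (ContDiffAt.congr_of_eventuallyEq ?_ hev)
  exact L.contDiff.contDiffAt.comp _ ((hTcd.restrict_scalars ℝ).of_le le_top)

end Regular

end Literature.AlgebraicGeometry.Motives.ComplexPoints

end
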